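import Literature.Topology.Immersions.OpenParallelizableImmersionCore
import Literature.Topology.Immersions.OpenParallelizableImmersionPoint
import Literature.Topology.Immersions.OpenParallelizableImmersionCompression
import HarnessLib

/-!
# Submersions of open parallelizable manifolds: the extension at a critical level

Topic `Literature/Topology/Immersions`; the extension half of a critical stage of the exhaustion in
the Gromov–Eliashberg–Mishachev route to Phillips' submersion theorem
(`Literature.Topology.Immersions.Phillips1967_exists_isLocalDiffeomorph_of_isParallelizable`). A
formal submersion `(f, Ψ)` of the framed manifold `Mⁿ⁺²`, holonomic near a closed set `U'`
containing the sublevel set `{ℓ ≤ c - ε₂}` of a Morse function `ℓ` with a critical point `p` of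
index `k` at level `c` (Morse chart `e`, `ℓ ∘ e⁻¹ = c - |y'|² + |y''|²`), is extended to a formal
submersion holonomic near `(U' ∖ e⁻¹B(0,R)) ∪ {ℓ ≤ c - ε'} ∪ e⁻¹(Q)`, `ε' = 16(n+2)ε₂`,
`Q = [-4√(n+2)√ε₂, 4√(n+2)√ε₂]ᵏ × 0 ⊇` the descending disc of radius `√ε'`, without
changing it off `e⁻¹B(0, R)`: for `k = 0` by `HolonomicNear.insert`, for `k ≥ 1` by the core
step `HolonomicNear.core` applied to the cube `Q` with the cubical attaching collar
`B = Q ∩ {‖y'‖∞ ≥ (7/4)√ε₂}` and the small closed set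
`U = (U' ∖ e⁻¹B(0,R)) ∪ {ℓ ≤ c - ε'} ∪ e⁻¹(B)` ("forgetting" the round part of `{ℓ ≤ c - ε₂}`
near `p`, so that `U` meets `e⁻¹(Q)` exactly along `e⁻¹(B)`), the analytic input being
holonomic approximation over a cube relative to a fixed collar (`HasCubeCollarApprox`,
Eliashberg–Mishachev 2002, Thm. 3.1.1).

* `Literature.Topology.Immersions.planeCube`, `Literature.Topology.Immersions.collarPart` — the
  cube `[-q, q]ᵏ × 0` of the coordinate `k`-plane and the region `{∃ i < k, q ≤ |yᵢ|}`.
* `Literature.Topology.Immersions.HasCubeCollarApprox n k` — the relative holonomic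
  approximation property (`IsRelHolApprox`) of the pairs (cube `qC`, collar `≥ qB`) for sections
  holonomic on open sets containing the collar `≥ qH`, for all `0 < qH < qB < qC`.
* `Literature.Topology.Immersions.HolonomicNear.criticalLevel` — the extension theorem.

## References

* A. Phillips, *Submersions of open manifolds*, Topology **6** (1967), Lemma 4.1, §6.
  [Phillips1967]
* Y. Eliashberg, N. Mishachev, *Introduction to the h-principle*, GSM 48 (2002), Thm. 3.1.1;
  *Holonomic approximation and Gromov's h-principle*, arXiv:math/0101196 (2001), §2.1.
  [EliashbergMishachev2001]
* J. Milnor, *Morse theory* (1963), §3. [Milnor1963]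
-/

open scoped Manifold ContDiff Topology
open Set Function Filter Bundle Module Metric

noncomputable section

namespace Literature.Topology.Immersions

/-! ### Cubes and collars in the coordinate `k`-plane -/

section Cube

variable {m : ℕ}

/-- The cube `[-q, q]ᵏ × 0` of the coordinate `k`-plane `{yᵢ = 0, i ≥ k}` of `ℝᵐ`. [folklore] -/
def planeCube (k : ℕ) (q : ℝ) : Set (EuclideanSpace ℝ (Fin m)) :=
  {y | (∀ i : Fin m, i.val < k → |y i| ≤ q) ∧ ∀ i : Fin m, k ≤ i.val → y i = 0}

/-- The region `{∃ i < k, q ≤ |yᵢ|}` (outside the open cube of half-width `q` in the first `k`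
coordinates). [folklore] -/
def collarPart (k : ℕ) (q : ℝ) : Set (EuclideanSpace ℝ (Fin m)) :=
  {y | ∃ i : Fin m, i.val < k ∧ q ≤ |y i|}

/-- Unfolding `planeCube`. [folklore] -/
theorem mem_planeCube {k : ℕ} {q : ℝ} {y : EuclideanSpace ℝ (Fin m)} :
    y ∈ planeCube k q ↔ (∀ i : Fin m, i.val < k → |y i| ≤ q) ∧ ∀ i : Fin m, k ≤ i.val → y i = 0 :=
  Iff.rfl

/-- Unfolding `collarPart`. [folklore] -/
theorem mem_collarPart {k : ℕ} {q : ℝ} {y : EuclideanSpace ℝ (Fin m)} :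
    y ∈ collarPart k q ↔ ∃ i : Fin m, i.val < k ∧ q ≤ |y i| :=
  Iff.rfl

/-- `collarPart` is closed. [folklore] -/
theorem isClosed_collarPart (k : ℕ) (q : ℝ) : IsClosed (collarPart (m := m) k q) := by
  have h1 : collarPart (m := m) k q = ⋃ i : Fin m, {y | i.val < k ∧ q ≤ |y i|} := by
    ext y; simp [collarPart, mem_iUnion]
  rw [h1]
  refine isClosed_iUnion_of_finite fun i => ?_
  by_cases hi : i.val < k
  · simpa [hi] using isClosed_le continuous_const ((continuous_apply i).comp
      (PiLp.continuous_ofLp 2 _)).abs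
  · simp [hi]

/-- `planeCube` is closed. [folklore] -/
theorem isClosed_planeCube (k : ℕ) (q : ℝ) : IsClosed (planeCube (m := m) k q) := by
  have h1 : planeCube (m := m) k q = (⋂ i : Fin m, {y | i.val < k → |y i| ≤ q}) ∩
      ⋂ i : Fin m, {y | k ≤ i.val → y i = 0} := by
    ext y; simp [planeCube, mem_iInter]
  rw [h1]
  refine (isClosed_iInter fun i => ?_).inter (isClosed_iInter fun i => ?_)
  · by_cases hi : i.val < k
    · simpa [hi] using isClosed_le ((continuous_apply i).comp
        (PiLp.continuous_ofLp 2 _)).abs continuous_const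
    · simp [hi]
  · by_cases hi : k ≤ i.val
    · simpa [hi] using isClosed_eq ((continuous_apply i).comp (PiLp.continuous_ofLp 2 _))
        continuous_const
    · simp [hi]

/-- On `planeCube`, `|y''|² = 0`. [folklore] -/
theorem highSq_eq_zero_of_mem_planeCube {k : ℕ} {q : ℝ} {y : EuclideanSpace ℝ (Fin m)}
    (hy : y ∈ planeCube k q) : highSq k y = 0 := by
  unfold highSq
  refine Finset.sum_eq_zero fun i hi => ?_
  simp [hy.2 i (Finset.mem_filter.1 hi).2]

/-- On `planeCube k q`, `|y'|² ≤ k q²`. [folklore] -/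
theorem lowSq_le_of_mem_planeCube {k : ℕ} {q : ℝ} {y : EuclideanSpace ℝ (Fin m)}
    (hy : y ∈ planeCube k q) : lowSq k y ≤ k * q ^ 2 := by
  unfold lowSq
  have hq : ∀ i ∈ Finset.univ.filter (fun i : Fin m => i.val < k), (y i) ^ 2 ≤ q ^ 2 := by
    intro i hi
    have h := hy.1 i (Finset.mem_filter.1 hi).2
    have h0 : 0 ≤ q := (abs_nonneg _).trans h
    nlinarith [abs_nonneg (y i), sq_abs (y i)]
  calc ∑ i ∈ Finset.univ.filter (fun i : Fin m => i.val < k), (y i) ^ 2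
      ≤ ∑ i ∈ Finset.univ.filter (fun i : Fin m => i.val < k), q ^ 2 := Finset.sum_le_sum hq
    _ = (Finset.univ.filter (fun i : Fin m => i.val < k)).card * q ^ 2 := by
        rw [Finset.sum_const, nsmul_eq_mul]
    _ ≤ k * q ^ 2 := by
        have hcard : ((Finset.univ.filter (fun i : Fin m => i.val < k)).card : ℝ) ≤ k := by
          have h1 : (Finset.univ.filter (fun i : Fin m => i.val < k)).card ≤ k := by
            calc (Finset.univ.filter (fun i : Fin m => i.val < k)).card
                ≤ (Finset.range k).card := by
                  refine Finset.card_le_card_of_injOn (fun i => i.val) (fun i hi => ?_) ?_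
                  · simpa using (Finset.mem_filter.1 hi).2
                  · intro i _ j _ hij
                    exact Fin.ext hij
              _ = k := Finset.card_range k
          exact_mod_cast h1
        nlinarith [sq_nonneg q]

/-- `planeCube k q` lies in the closed ball of radius `r` as soon as `k q² ≤ r²`, `0 ≤ r`. [folklore] -/
theorem planeCube_subset_closedBall {k : ℕ} {q r : ℝ} (hr : 0 ≤ r) (hqr : k * q ^ 2 ≤ r ^ 2) :
    planeCube (m := m) k q ⊆ closedBall 0 r := by
  intro y hy
  rw [mem_closedBall, dist_zero_right]
  have h1 : ‖y‖ ^ 2 ≤ r ^ 2 := by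
    rw [← lowSq_add_highSq k y, highSq_eq_zero_of_mem_planeCube hy, add_zero]
    exact (lowSq_le_of_mem_planeCube hy).trans hqr
  exact le_of_pow_le_pow_left₀ two_ne_zero hr h1

/-- `planeCube` is compact. [folklore] -/
theorem isCompact_planeCube (k : ℕ) (q : ℝ) : IsCompact (planeCube (m := m) k q) := by
  refine (isCompact_closedBall (0 : EuclideanSpace ℝ (Fin m)) (Real.sqrt (k * q ^ 2))).of_isClosed_subset
    (isClosed_planeCube k q) (planeCube_subset_closedBall (Real.sqrt_nonneg _) ?_)
  rw [Real.sq_sqrt (by positivity)]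

/-- The descending disc `{y'' = 0, |y'|² ≤ q²}` lies in `planeCube k q` (`0 ≤ q`). [folklore] -/
theorem mem_planeCube_of_disc {k : ℕ} {q : ℝ} (hq : 0 ≤ q) {y : EuclideanSpace ℝ (Fin m)}
    (h0 : highSq k y = 0) (h1 : lowSq k y ≤ q ^ 2) : y ∈ planeCube k q := by
  refine ⟨fun i hi => ?_, fun i hi => ?_⟩
  · have h := (sq_le_lowSq y hi).trans h1
    exact abs_le_of_sq_le_sq h hq
  · have h := sq_le_highSq y hi
    rw [h0] at h
    exact pow_eq_zero_iff (n := 2) (by norm_num) |>.1 (le_antisymm h (sq_nonneg _))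

/-- On `collarPart k q` (`0 ≤ q`), `|y'|² ≥ q²`. [folklore] -/
theorem sq_le_lowSq_of_mem_collarPart {k : ℕ} {q : ℝ} (hq : 0 ≤ q) {y : EuclideanSpace ℝ (Fin m)}
    (hy : y ∈ collarPart k q) : q ^ 2 ≤ lowSq k y := by
  obtain ⟨i, hi, hq'⟩ := hy
  calc q ^ 2 ≤ |y i| ^ 2 := by gcongr
    _ = (y i) ^ 2 := sq_abs _
    _ ≤ lowSq k y := sq_le_lowSq y hi

/-- Pigeonhole: if `|y'|² ≥ k q²` with `k ≥ 1`, `q > 0`, some coordinate `i < k` has `|yᵢ| ≥ q`. [folklore] -/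
theorem mem_collarPart_of_le_lowSq {k : ℕ} (hk : 1 ≤ k) {q : ℝ} (hq : 0 < q)
    {y : EuclideanSpace ℝ (Fin m)} (hy : k * q ^ 2 ≤ lowSq k y) : y ∈ collarPart k q := by
  by_contra hcon
  simp only [mem_collarPart, not_exists, not_and, not_le] at hcon
  have hlt : ∀ i ∈ Finset.univ.filter (fun i : Fin m => i.val < k), (y i) ^ 2 < q ^ 2 := by
    intro i hi
    have h := hcon i (Finset.mem_filter.1 hi).2
    have : |y i| ^ 2 < q ^ 2 := by gcongr
    simpa [sq_abs] using this
  rcases (Finset.univ.filter (fun i : Fin m => i.val < k)).eq_empty_or_nonempty with he | hne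
  · have h0 : lowSq k y = 0 := by simp [lowSq, he]
    rw [h0] at hy
    have : (0 : ℝ) < k * q ^ 2 := by
      have : (1 : ℝ) ≤ k := by exact_mod_cast hk
      positivity
    linarith
  · have hsum : lowSq k y < (Finset.univ.filter (fun i : Fin m => i.val < k)).card * q ^ 2 := by
      unfold lowSq
      calc ∑ i ∈ Finset.univ.filter (fun i : Fin m => i.val < k), (y i) ^ 2
          < ∑ i ∈ Finset.univ.filter (fun i : Fin m => i.val < k), q ^ 2 :=
            Finset.sum_lt_sum_of_nonempty hne hlt
        _ = _ := by rw [Finset.sum_const, nsmul_eq_mul]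
    have hcard : ((Finset.univ.filter (fun i : Fin m => i.val < k)).card : ℝ) ≤ k := by
      have h1 : (Finset.univ.filter (fun i : Fin m => i.val < k)).card ≤ k := by
        calc (Finset.univ.filter (fun i : Fin m => i.val < k)).card
            ≤ (Finset.range k).card := by
              refine Finset.card_le_card_of_injOn (fun i => i.val) (fun i hi => ?_) ?_
              · simpa using (Finset.mem_filter.1 hi).2
              · intro i _ j _ hij
                exact Fin.ext hij
          _ = k := Finset.card_range k
      exact_mod_cast h1
    nlinarith [sq_nonneg q]

/-- The cube used at a critical level lies in the chart ball: if `k ≤ K`, `1 ≤ K` and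
`25 K² ε₂ < R²` then `[-4√K√ε₂, 4√K√ε₂]ᵏ × 0 ⊆ B(0, R)`. [folklore] -/
theorem planeCube_subset_ball_of_le {k : ℕ} {K ε₂ R : ℝ} (hk : (k : ℝ) ≤ K) (hK : 1 ≤ K)
    (hε₂ : 0 < ε₂) (hR : 0 < R) (hsmall : 25 * K ^ 2 * ε₂ < R ^ 2) :
    planeCube (m := m) k (4 * Real.sqrt K * Real.sqrt ε₂) ⊆ ball 0 R := by
  have hss : Real.sqrt ε₂ ^ 2 = ε₂ := Real.sq_sqrt hε₂.le
  have hKK : Real.sqrt K ^ 2 = K := Real.sq_sqrt (by linarith)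
  have h1 : planeCube (m := m) k (4 * Real.sqrt K * Real.sqrt ε₂) ⊆
      closedBall 0 (4 * K * Real.sqrt ε₂) := by
    refine planeCube_subset_closedBall (by positivity) ?_
    have : (4 * Real.sqrt K * Real.sqrt ε₂) ^ 2 = 16 * K * ε₂ := by
      rw [mul_pow, mul_pow, hss, hKK]; ring
    rw [this]
    have h0 : (0 : ℝ) ≤ k := by positivity
    nlinarith [hss]
  refine h1.trans (closedBall_subset_ball ?_)
  have h2 : (4 * K * Real.sqrt ε₂) ^ 2 < R ^ 2 := by
    calc (4 * K * Real.sqrt ε₂) ^ 2 = 16 * K ^ 2 * ε₂ := by rw [mul_pow, mul_pow, hss]; ring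
      _ < R ^ 2 := by nlinarith [sq_nonneg K]
  exact lt_of_pow_lt_pow_left₀ 2 hR.le h2

/-- `planeCube 0 q = {0}`. [folklore] -/
theorem planeCube_zero (q : ℝ) : planeCube (m := m) 0 q = {0} := by
  ext y
  simp only [mem_planeCube, Nat.not_lt_zero, IsEmpty.forall_iff, implies_true, zero_le,
    forall_const, true_and, mem_singleton_iff]
  constructor
  · intro h; ext i; simpa using h i
  · intro h i; simp [h]

end Cube

/-! ### The analytic input: holonomic approximation over cubes relative to a collar -/

section Input

/-- **Relative holonomic approximation over cubes, collar form** (the shape in which the handle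
steps consume Eliashberg–Mishachev's Thm. 3.1.1 / 2001 Thm. 1.3.1): for all `0 < qH < qB < qC`
the pair (cube `[-qC, qC]ᵏ × 0`, its part of sup-norm `≥ qB`) has the relative holonomic
approximation property `IsRelHolApprox` for every `1`-jet section holonomic on an open set
containing the part of the cube of sup-norm `≥ qH`. [cite: EliashbergMishachev2001, Thm. 1.3.1] -/
structure HasCubeCollarApprox (n k : ℕ) : Prop where
  /-- The approximation property for all admissible scales and data. -/
  out : ∀ (qH qB qC : ℝ), 0 < qH → qH < qB → qB < qC →
    ∀ (F₀ : EuclideanSpace ℝ (Fin (n + 2)) → EuclideanSpace ℝ (Fin (n + 2)))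
      (F₁ : EuclideanSpace ℝ (Fin (n + 2)) →
        EuclideanSpace ℝ (Fin (n + 2)) →L[ℝ] EuclideanSpace ℝ (Fin (n + 2)))
      (φ₀ : EuclideanSpace ℝ (Fin (n + 2)) → EuclideanSpace ℝ (Fin (n + 2)))
      (O' : Set (EuclideanSpace ℝ (Fin (n + 2)))) (ε δ : ℝ),
      Continuous F₀ → Continuous F₁ → ContDiff ℝ ∞ φ₀ → IsOpen O' →
      planeCube k qC ∩ collarPart k qH ⊆ O' →
      (∀ x ∈ O', φ₀ x = F₀ x ∧ fderiv ℝ φ₀ x = F₁ x) → 0 < ε → 0 < δ →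
      ∃ (H : ℝ → EuclideanSpace ℝ (Fin (n + 2)) → EuclideanSpace ℝ (Fin (n + 2)))
        (E Ω : Set (EuclideanSpace ℝ (Fin (n + 2))))
        (g : EuclideanSpace ℝ (Fin (n + 2)) → EuclideanSpace ℝ (Fin (n + 2))),
        IsRelHolApprox (planeCube k qC) (planeCube k qC ∩ collarPart k qB) O' F₀ F₁ φ₀ ε δ H E Ω g

end Input

/-! ### The extension at a critical level -/

section Critical

variable {n : ℕ} {M : Type*} [TopologicalSpace M]
  [ChartedSpace (EuclideanSpace ℝ (Fin (n + 2))) M] [IsManifold (𝓡 (n + 2)) ∞ M] [T2Space M]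

/-- Local notation: the model space `ℝⁿ⁺²`. -/
local notation "𝔼₂" => EuclideanSpace ℝ (Fin (n + 2))

open Classical in
/-- **Extension of a formal submersion at a critical level** (Phillips 1967, Lemma 4.1 and §6,
in the formal-solution language; Milnor 1963, §3 for the geometry). Let `σ` be a continuous
frame of `Mⁿ⁺²`, `(f, Ψ)` a formal submersion holonomic near the closed set `U'`, `ℓ` a `C^∞`
function, `e` a chart of the maximal atlas with `B̄(0, R) ⊆ e.target` on which
`ℓ ∘ e⁻¹ = c - |y'|² + |y''|²` (`y' = (yᵢ)_{i<k}`, `k ≤ n + 2`), `0 < ε₂`, `25 (n+2)² ε₂ < R²`,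
such that `U'` contains the points of `e⁻¹B(0, R)` with `ℓ ≤ c - ε₂` and all points with
`ℓ ≤ c - 16(n+2)ε₂`, and assume `HasCubeCollarApprox n k` if `k ≥ 1`. Then there is a formal
submersion `(g, Ψ')`, equal to `(f, Ψ)` at every `x` with `x ∉ e.source` or `e x ∉ B(0, R)`,
holonomic near `(U' ∖ e⁻¹B(0, R)) ∪ {ℓ ≤ c - 16(n+2)ε₂} ∪ e⁻¹([-4√(n+2)√ε₂, 4√(n+2)√ε₂]ᵏ × 0)`
(the scale `n + 2` dominates every index, so that several critical points on one level can be
treated one after the other with the same `ε' = 16(n+2)ε₂`). [cite: Phillips1967, Lemma 4.1 and §6] -/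
theorem HolonomicNear.criticalLevel {σ : Fin (n + 2) → M → 𝔼₂}
    (hσ : ∀ i, Continuous fun x => (⟨x, σ i x⟩ : TangentBundle (𝓡 (n + 2)) M))
    (hli : ∀ x, LinearIndependent ℝ fun i => σ i x) {f : M → 𝔼₂} {Ψ : M → Fin (n + 2) → 𝔼₂}
    {U' : Set M} (h : HolonomicNear σ f Ψ U') (hU'c : IsClosed U') {k : ℕ} (hkn : k ≤ n + 2)
    (hcube : 1 ≤ k → HasCubeCollarApprox n k)
    {ℓ : M → ℝ} (hℓ : ContMDiff (𝓡 (n + 2)) 𝓘(ℝ, ℝ) ∞ ℓ) {c ε₂ : ℝ} (hε₂ : 0 < ε₂)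
    {e : OpenPartialHomeomorph M 𝔼₂} (he : e ∈ IsManifold.maximalAtlas (𝓡 (n + 2)) ∞ M)
    {R : ℝ} (hR : 0 < R) (hRe : closedBall (0 : 𝔼₂) R ⊆ e.target)
    (hℓe : ∀ y ∈ e.target, ℓ (e.symm y) = c - lowSq k y + highSq k y)
    (hsmall : 25 * (n + 2) ^ 2 * ε₂ < R ^ 2)
    (hU'N : ∀ x ∈ e.symm '' ball (0 : 𝔼₂) R, ℓ x ≤ c - ε₂ → x ∈ U')
    (hU'ε : ∀ x, ℓ x ≤ c - 16 * (n + 2) * ε₂ → x ∈ U') :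
    ∃ (g : M → 𝔼₂) (Ψ' : M → Fin (n + 2) → 𝔼₂),
      HolonomicNear σ g Ψ' ((U' \ e.symm '' ball (0 : 𝔼₂) R) ∪ {x | ℓ x ≤ c - 16 * (n + 2) * ε₂} ∪
        e.symm '' planeCube k (4 * Real.sqrt (n + 2) * Real.sqrt ε₂)) ∧
      ∀ x, (x ∈ e.source → e x ∉ ball (0 : 𝔼₂) R) → g x = f x ∧ Ψ' x = Ψ x := by
  -- scales (`kh = n + 2` dominates every index)
  have hkhr : (1 : ℝ) ≤ (n : ℝ) + 2 := by
    have : (0 : ℝ) ≤ n := by positivity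
    linarith
  have hkk : (k : ℝ) ≤ (n : ℝ) + 2 := by exact_mod_cast hkn
  set s : ℝ := Real.sqrt ε₂ with hs
  have hs0 : 0 < s := Real.sqrt_pos.2 hε₂
  have hss : s ^ 2 = ε₂ := Real.sq_sqrt hε₂.le
  set sk : ℝ := Real.sqrt ((n : ℝ) + 2) with hsk
  have hsk1 : 1 ≤ sk := by rw [hsk]; exact Real.one_le_sqrt.2 hkhr
  have hsksq : sk ^ 2 = (n : ℝ) + 2 := Real.sq_sqrt (by positivity)
  set ε' : ℝ := 16 * ((n : ℝ) + 2) * ε₂ with hε'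
  set qC : ℝ := 4 * sk * s with hqC
  have hqC0 : 0 ≤ qC := by positivity
  have hqCsq : qC ^ 2 = ε' := by
    rw [hqC, hε']; nlinarith [hsksq, hss]
  set Q : Set 𝔼₂ := planeCube k qC with hQ
  have hQc : IsCompact Q := isCompact_planeCube k qC
  -- the cube and its tube lie in the chart ball
  set r₁ : ℝ := 4 * ((n : ℝ) + 2) * s with hr₁
  have hQball : Q ⊆ closedBall (0 : 𝔼₂) r₁ := by
    refine planeCube_subset_closedBall (by positivity) ?_
    rw [hqCsq, hε', hr₁]
    nlinarith [hss, hkk, show (0 : ℝ) ≤ k from by positivity]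
  have h5 : 5 * ((n : ℝ) + 2) * s < R := by
    have h1 : (5 * ((n : ℝ) + 2) * s) ^ 2 < R ^ 2 := by
      calc (5 * ((n : ℝ) + 2) * s) ^ 2 = 25 * ((n : ℝ) + 2) ^ 2 * ε₂ := by
            rw [mul_pow, mul_pow, hss]; ring
        _ < R ^ 2 := hsmall
    exact lt_of_pow_lt_pow_left₀ 2 hR.le h1
  have hr₁R : r₁ + s < R := by rw [hr₁]; nlinarith
  have hcth : cthickening s Q ⊆ closedBall (0 : 𝔼₂) (r₁ + s) := by
    refine (cthickening_subset_of_subset s hQball).trans ?_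
    rw [cthickening_closedBall hs0.le (by positivity)]
    exact closedBall_subset_closedBall (by linarith)
  have hcth_ball : cthickening s Q ⊆ ball (0 : 𝔼₂) R :=
    hcth.trans (closedBall_subset_ball hr₁R)
  have hth_ball : thickening s Q ⊆ ball (0 : 𝔼₂) R :=
    (thickening_subset_cthickening s Q).trans hcth_ball
  have hballt : ball (0 : 𝔼₂) R ⊆ e.target := ball_subset_closedBall.trans hRe
  have hQt : Q ⊆ e.target := fun y hy =>
    hballt (hcth_ball (self_subset_cthickening Q hy))
  have hQballR : Q ⊆ ball (0 : 𝔼₂) R := fun y hy => hcth_ball (self_subset_cthickening Q hy)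
  -- the chart ball read in `M`
  set N : Set M := e.symm '' ball (0 : 𝔼₂) R with hN
  have hNopen : IsOpen N := e.symm.isOpen_image_of_subset_source isOpen_ball hballt
  have hnotN : ∀ x, (x ∈ e.source → e x ∉ ball (0 : 𝔼₂) R) → x ∉ N := by
    rintro x hx ⟨y, hy, rfl⟩
    exact hx (e.map_target (hballt hy)) (by rwa [e.right_inv (hballt hy)])
  -- the level function read in the chart
  have hℓQ : ∀ y ∈ Q, ℓ (e.symm y) = c - lowSq k y := fun y hy => by
    rw [hℓe y (hQt hy), highSq_eq_zero_of_mem_planeCube hy, add_zero]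
  have hε'ε : ε₂ ≤ ε' := by
    rw [hε']; nlinarith
  -- the two closed pieces kept from `U'`
  set U₀ : Set M := (U' \ N) ∪ {x | ℓ x ≤ c - ε'} with hU₀
  have hU₀c : IsClosed U₀ := (hU'c.sdiff hNopen).union (isClosed_le hℓ.continuous continuous_const)
  have hU₀U' : U₀ ⊆ U' := by
    rintro x (hx | hx)
    · exact hx.1
    · exact hU'ε x hx
  rcases Nat.eq_zero_or_pos k with hk0 | hkpos
  · -- ### index `0`: insert the point `p = e⁻¹ 0`
    subst hk0
    have h0t : (0 : 𝔼₂) ∈ e.target := hballt (mem_ball_self hR)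
    set p : M := e.symm 0 with hp
    have hpN : p ∈ N := ⟨0, mem_ball_self hR, rfl⟩
    have hℓp : ℓ p = c := by
      rw [hp, hℓe 0 h0t]; simp [lowSq, highSq]
    have hpU₀ : p ∉ U₀ := by
      rintro (hx | hx)
      · exact hx.2 hpN
      · have : (0 : ℝ) < ε' := by rw [hε']; positivity
        simp only [mem_setOf_eq, hℓp] at hx
        linarith
    obtain ⟨g, Ψ', hg, hgf, hΨf⟩ :=
      (h.mono hU₀U').insert hσ hli hU₀c hpU₀ (hNopen.mem_nhds hpN)
    refine ⟨g, Ψ', hg.mono ?_, fun x hx => ⟨hgf x (hnotN x hx), hΨf x (hnotN x hx)⟩⟩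
    rintro x (hx | ⟨y, hy, rfl⟩)
    · exact Or.inr hx
    · simp only [hQ, planeCube_zero, mem_singleton_iff] at hy
      rw [hy]
      exact Or.inl rfl
  · -- ### index `k ≥ 1`: the core step over the cube `Q`
    have hk : 1 ≤ k := hkpos
    set qB : ℝ := 7 / 4 * s with hqB
    set B : Set 𝔼₂ := Q ∩ collarPart k qB with hB
    have hBc : IsCompact B := hQc.inter_right (isClosed_collarPart k qB)
    set U : Set M := U₀ ∪ e.symm '' B with hU
    have hUc : IsClosed U :=
      hU₀c.union ((hBc.image_of_continuousOn (e.continuousOn_symm.mono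
        (inter_subset_left.trans hQt))).isClosed)
    -- `B` read back lies below the level `c - ε₂`
    have hBU' : ∀ y ∈ B, e.symm y ∈ U' := by
      intro y hy
      refine hU'N _ ⟨y, hQballR hy.1, rfl⟩ ?_
      rw [hℓQ y hy.1]
      have h1 : qB ^ 2 ≤ lowSq k y := sq_le_lowSq_of_mem_collarPart (by positivity) hy.2
      have h2 : ε₂ ≤ qB ^ 2 := by rw [hqB, mul_pow, hss]; nlinarith
      linarith
    have hUU' : U ⊆ U' := by
      rintro x (hx | ⟨y, hy, rfl⟩)
      · exact hU₀U' hx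
      · exact hBU' y hy
    -- the attaching condition: `e⁻¹(y) ∈ U`, `y ∈ Q` force `y ∈ B`
    have hUC : ∀ y ∈ Q, e.symm y ∈ U → y ∈ B := by
      intro y hyQ hyU
      rcases hyU with (hx | hx) | ⟨y', hy', hyy'⟩
      · exact absurd ⟨y, hQballR hyQ, rfl⟩ hx.2
      · refine ⟨hyQ, ?_⟩
        have h1 : (k : ℝ) * (4 * s) ^ 2 ≤ lowSq k y := by
          simp only [mem_setOf_eq, hℓQ y hyQ] at hx
          have : (k : ℝ) * (4 * s) ^ 2 ≤ ε' := by
            rw [hε', mul_pow, hss]; nlinarith [hkk]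
          linarith
        obtain ⟨i, hi, hyi⟩ := mem_collarPart_of_le_lowSq hk (by positivity) h1
        exact ⟨i, hi, le_trans (by rw [hqB]; linarith) hyi⟩
      · have hinj := e.symm.injOn (hQt hy'.1) (hQt hyQ) hyy'
        rw [← hinj]; exact hy'
    -- the analytic input
    have happrox : ∀ (F₀ : 𝔼₂ → 𝔼₂) (F₁ : 𝔼₂ → 𝔼₂ →L[ℝ] 𝔼₂) (φ₀ : 𝔼₂ → 𝔼₂) (O' : Set 𝔼₂)
        (ε δ : ℝ), Continuous F₀ → Continuous F₁ → ContDiff ℝ ∞ φ₀ → IsOpen O' →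
        (∀ y ∈ Q, e.symm y ∈ U' → y ∈ O') →
        (∀ x ∈ O', φ₀ x = F₀ x ∧ fderiv ℝ φ₀ x = F₁ x) → 0 < ε → 0 < δ →
        ∃ (H : ℝ → 𝔼₂ → 𝔼₂) (E' Ω : Set 𝔼₂) (g : 𝔼₂ → 𝔼₂),
          IsRelHolApprox Q B O' F₀ F₁ φ₀ ε δ H E' Ω g := by
      intro F₀ F₁ φ₀ O' ε δ h₀ h₁ hφ₀ hO' hprem hhol hε hδ
      have hqHB : s < qB := by rw [hqB]; linarith
      have hqBC : qB < qC := by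
        rw [hqB, hqC]; nlinarith
      refine (hcube hk).out s qB qC hs0 hqHB hqBC F₀ F₁ φ₀ O' ε δ h₀ h₁ hφ₀ hO' ?_ hhol hε hδ
      rintro y ⟨hyQ, hyH⟩
      refine hprem y hyQ (hU'N _ ⟨y, hQballR hyQ, rfl⟩ ?_)
      rw [hℓQ y hyQ]
      have h1 : s ^ 2 ≤ lowSq k y := sq_le_lowSq_of_mem_collarPart hs0.le hyH
      linarith
    obtain ⟨g, Ψ', hg, hoff⟩ := h.core hσ hli hUc hUU' he hQc hs0
      (hcth_ball.trans hballt) hUC happrox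
    refine ⟨g, Ψ', hg.mono ?_, fun x hx => hoff x fun hxs hxt => hx hxs (hth_ball hxt)⟩
    rintro x ((hx | hx) | hx)
    · exact Or.inl (Or.inl (Or.inl hx))
    · exact Or.inl (Or.inl (Or.inr hx))
    · exact Or.inr hx

end Critical

end Literature.Topology.Immersions
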